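import Summits.QuantumFields.BalabanUV.Beta.GraphPoissonKernel

/-!
# `Summit.QuantumFields.BalabanUV.Beta.GraphPoissonLocality` — LOCALITY of the harmonic extension and of the Poisson kernel: they
# depend on the bond weights only through the bonds touching `B` (generic finite bond structure) — the kernel half of the
# identification «the Dirichlet problem of a torus ball below half the period is the one of `ℤ^d`» used when a printed harmonic-measure
# lemma is read in the tree's vocabulary (row-D4 owner's ruling R-an4-45-1 §5(a))

HONEST FRAMING (page 1 of everything in this cell).  Discharging `FlowStep.BetaPertH` would make Bałaban's ultraviolet
stability UNCONDITIONAL — a constructive-QFT result; it is NOT the continuum limit and NOT the Clay problem.  This module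
discharges nothing of `BetaPertH`; it is [folklore] bookkeeping on a finite bond structure, kernel-checked, by CO-OWNER #3 of binder row D4
(unit `b2b-balaban-beta-d4-p3`, road P3 «reduction road», gen 12).  HONEST DEPENDENCY: continuum YM on T⁴ ⇐ BetaPertH ∧ nine spine
estimates (0/9 proved); BetaPertH ⇐ (D1) ∧ (D4) ∧ CAP+tail; G-an2-4 gates asym, D1 and NE2/3/4.

CONTENT.  Two weight functions `c, c'` on the same bond structure `src, tgt : Bd → St` that AGREE ON EVERY BOND TOUCHING `B`
(`src b ∈ B ∨ tgt b ∈ B ⟹ c b = c' b`) have, on a set `B` carrying a nonnegative unit supersolution (for `c`):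
* `unit_supersolution_congr` — the same unit supersolution for `c'`;
* `harmonic_congr` — the same harmonic functions on `B`;
* **`harmExt_congr_weights`** — the same harmonic extension of every exterior datum;
* **`poisson_congr_weights`** — the same Poisson kernel.
So a pointwise statement about `poisson B x y` for one weight function transfers verbatim to any weight function agreeing with it near
`B` — e.g. from the unit-weight torus to a torus carrying other weights far from the ball, or (with a chart) to `ℤ^d`.

LOCATORS (shape only; ABSOLUTE RULE): [Balaban1985BackgroundPropagators] p. 394 (`Ω₀Δ′Ω₀`).  Row D4: NO class change (critical-path
width 0; D4 DISCHARGE NO DATE); NOT BetaPertH, NOT continuum, NOT Clay, NOT summit progress.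
-/

open scoped BigOperators
open Finset

namespace Summit.QuantumFields.BalabanUV.Beta.GraphPoissonLocality

open Summit.QuantumFields.BalabanUV.Beta.GraphHarmonicExtension
open Summit.QuantumFields.BalabanUV.Beta.GraphPoissonKernel

noncomputable section

variable {St Bd : Type} [Fintype St] [Fintype Bd] [DecidableEq St] (src tgt : Bd → St) (c c' : Bd → ℝ) (B : Finset St)
  (hcc' : ∀ b, (src b ∈ B ∨ tgt b ∈ B) → c b = c' b)

include hcc'

omit [Fintype St] in
/-- At a site of `B`, the diagonal weight is the same for `c` and `c'`. [folklore] -/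
theorem wdeg_congr (x : St) (hx : x ∈ B) :
    ((∑ b ∈ univ.filter (fun b => tgt b = x), c b ^ 2) + ∑ b ∈ univ.filter (fun b => src b = x), c b ^ 2) =
      ((∑ b ∈ univ.filter (fun b => tgt b = x), c' b ^ 2) + ∑ b ∈ univ.filter (fun b => src b = x), c' b ^ 2) := by
  congr 1
  · exact Finset.sum_congr rfl fun b hb => by rw [hcc' b (Or.inr ((mem_filter.mp hb).2 ▸ hx))]
  · exact Finset.sum_congr rfl fun b hb => by rw [hcc' b (Or.inl ((mem_filter.mp hb).2 ▸ hx))]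

omit [Fintype St] in
/-- At a site of `B`, the neighbour sum of any function is the same for `c` and `c'`. [folklore] -/
theorem nbsum_congr (u : St → ℝ) (x : St) (hx : x ∈ B) :
    ((∑ b ∈ univ.filter (fun b => tgt b = x), c b ^ 2 * u (src b)) + ∑ b ∈ univ.filter (fun b => src b = x), c b ^ 2 * u (tgt b)) =
      ((∑ b ∈ univ.filter (fun b => tgt b = x), c' b ^ 2 * u (src b)) + ∑ b ∈ univ.filter (fun b => src b = x), c' b ^ 2 * u (tgt b)) := by
  congr 1
  · exact Finset.sum_congr rfl fun b hb => by rw [hcc' b (Or.inr ((mem_filter.mp hb).2 ▸ hx))]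
  · exact Finset.sum_congr rfl fun b hb => by rw [hcc' b (Or.inl ((mem_filter.mp hb).2 ▸ hx))]

omit [Fintype St] in
/-- A unit supersolution on `B` for `c` is one for `c'`. [folklore] -/
theorem unit_supersolution_congr (w₀ : St → ℝ)
    (hw₀ : ∀ x ∈ B, 1 + ((∑ b ∈ univ.filter (fun b => tgt b = x), c b ^ 2 * w₀ (src b)) +
        ∑ b ∈ univ.filter (fun b => src b = x), c b ^ 2 * w₀ (tgt b)) ≤
      ((∑ b ∈ univ.filter (fun b => tgt b = x), c b ^ 2) + ∑ b ∈ univ.filter (fun b => src b = x), c b ^ 2) * w₀ x) :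
    ∀ x ∈ B, 1 + ((∑ b ∈ univ.filter (fun b => tgt b = x), c' b ^ 2 * w₀ (src b)) +
        ∑ b ∈ univ.filter (fun b => src b = x), c' b ^ 2 * w₀ (tgt b)) ≤
      ((∑ b ∈ univ.filter (fun b => tgt b = x), c' b ^ 2) + ∑ b ∈ univ.filter (fun b => src b = x), c' b ^ 2) * w₀ x := by
  intro x hx
  rw [← nbsum_congr src tgt c c' B hcc' w₀ x hx, ← wdeg_congr src tgt c c' B hcc' x hx]
  exact hw₀ x hx

/-- **LOCALITY OF THE HARMONIC EXTENSION**: if `c` and `c'` agree on every bond touching `B` (and `B` carries a nonnegative unit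
supersolution), then `harmExt c B g = harmExt c' B g` for every exterior datum `g`. [folklore] -/
theorem harmExt_congr_weights (w₀ : St → ℝ) (hw₀0 : ∀ y, 0 ≤ w₀ y)
    (hw₀ : ∀ x ∈ B, 1 + ((∑ b ∈ univ.filter (fun b => tgt b = x), c b ^ 2 * w₀ (src b)) +
        ∑ b ∈ univ.filter (fun b => src b = x), c b ^ 2 * w₀ (tgt b)) ≤
      ((∑ b ∈ univ.filter (fun b => tgt b = x), c b ^ 2) + ∑ b ∈ univ.filter (fun b => src b = x), c b ^ 2) * w₀ x)
    (g : St → ℝ) : harmExt src tgt c B g = harmExt src tgt c' B g := by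
  have hw₀' := unit_supersolution_congr src tgt c c' B hcc' w₀ hw₀
  refine harmExt_unique src tgt c' B w₀ hw₀0 hw₀' g _ (fun x hx => harmExt_eq_off src tgt c B w₀ hw₀0 hw₀ g x hx) (fun x hx => ?_)
  rw [← nbsum_congr src tgt c c' B hcc' _ x hx, ← wdeg_congr src tgt c c' B hcc' x hx]
  exact harmExt_harmonic src tgt c B w₀ hw₀0 hw₀ g x hx

/-- **LOCALITY OF THE POISSON KERNEL**: under the same hypotheses, `poisson c B x y = poisson c' B x y`. [folklore] -/
theorem poisson_congr_weights (w₀ : St → ℝ) (hw₀0 : ∀ y, 0 ≤ w₀ y)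
    (hw₀ : ∀ x ∈ B, 1 + ((∑ b ∈ univ.filter (fun b => tgt b = x), c b ^ 2 * w₀ (src b)) +
        ∑ b ∈ univ.filter (fun b => src b = x), c b ^ 2 * w₀ (tgt b)) ≤
      ((∑ b ∈ univ.filter (fun b => tgt b = x), c b ^ 2) + ∑ b ∈ univ.filter (fun b => src b = x), c b ^ 2) * w₀ x)
    (x y : St) : poisson src tgt c B x y = poisson src tgt c' B x y := by
  rw [poisson, poisson, harmExt_congr_weights src tgt c c' B hcc' w₀ hw₀0 hw₀]

end

end Summit.QuantumFields.BalabanUV.Beta.GraphPoissonLocality
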